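import Mathlib
import Literature.NumberTheory.LFunctions.Zhang2022.Section15ResidueEstimates
import Literature.NumberTheory.LFunctions.Zhang2022.Section15ResidueRstar
import Literature.NumberTheory.LFunctions.Zhang2022.Section5Lemma54Discharge
import HarnessLib

/-!
# Zhang (2022) §15 p. 88: `ℛ₁*ℛ₁ⱼ = 1, 2, 1 + O(1/𝓛)` (Z22:§15.u060–u062) discharged modulo Lemma 5.4 (ii)

Topic `Literature/NumberTheory/LFunctions/Zhang2022` (Landau–Siegel audit tree; verdict-neutral).
Y. Zhang, *Discrete mean estimates and the Landau–Siegel zero*, arXiv:2211.02515v1 (2022)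
[Zhang2022LandauSiegel] — **an unrefereed manuscript under adjudication** (cell siegel-zhang, D-0069
width campaign). DISCHARGE file (theorems only; no new definitions, no new facts); no statement about
Theorems 1–2 of the manuscript or about Landau–Siegel zeros is made or implied.

DAG `Z22:§15.u060`–`u062` [Z22 p.88, tex L4385–L4392] ("Hence, by direct calculation, `ℛ₁*ℛ₁₁ = 1 +
O(1/𝓛)`, `ℛ₁*ℛ₁₂ = 2 + O(1/𝓛)`, `ℛ₁*ℛ₁₃ = 1 + O(1/𝓛)`") for every instantiation `X : Inputs15AB` of
the §15A/B objects whose fields `ℛ₁*` and `ℛ₁ⱼ` ARE the typed bodies (`L(1+β₁,χ)L(1+β₂,χ)δ(1)/L′(1,χ)`,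
resp. the `limUnder` residue `Typed.Section15B.calR1`), the ONLY hypothesis being the CLAIM node
`Skeleton.Lemma54` (Lemma 5.4 (ii), `δ(1) = 1 + O(α log 𝓛)`): `step15_u060_of_lemma54`,
`step15_u061_of_lemma54`, `step15_u062_of_lemma54`. Route (bypassing the printed `Z22:§15.u059`, whose
absolute `O(𝓛⁻³)` does not follow — GAP-LEDGER G-d53-1): `ℛ₁* = β₁β₂L′ + O(𝓛⁻²⁴)`
(`step15_u058_of_lemma54`), `ℛ₁ⱼ = M₁ⱼ(1 + O(𝓛⁻⁶))` (`calR1_*_rel`, unconditional under (A)),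
`β₁β₂L′·M₁ⱼ = β₁β₂P₄^{β₃−βⱼ}/((β_{j+1}−βⱼ)(β_{j+2}−βⱼ)) = v_j + O(1/𝓛)` (`mainTerm_*`), and the relative
product estimate `product_core_rel`. Since Lemma 5.4 is a theorem of the tree (`Skeleton.lemma54_holds`,
`Section5Lemma54Discharge`), the nodes HOLD outright for such `X`: `step15_u060_holds`, `step15_u061_holds`,
`step15_u062_holds`.
-/

noncomputable section

open Complex Real Filter Topology

namespace Literature.NumberTheory.LFunctions.Zhang2022.ResidueValues

open Skeleton Typed.Section15B Typed.Section15C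

variable (c' : ℝ) (X : Typed.Section15C.Inputs15AB)

/-- The relative product estimate: `R* = m + O(ε₁)`, `R = M(1 + O(η))` (`η ≤ 1`), `|M| ≤ B`,
`mM = v + O(δ)` give `R*R = v + O(δ + (|v|+δ)η + 2ε₁B)`. [cite: Zhang2022LandauSiegel, §15 p. 88] -/
theorem product_core_rel {R Rs m M v : ℂ} {ε₁ η B δ : ℝ} (h1 : ‖Rs - m‖ ≤ ε₁)
    (h2 : ‖R - M‖ ≤ η * ‖M‖) (hη : 0 ≤ η) (hη1 : η ≤ 1) (hB : ‖M‖ ≤ B) (hδ : ‖m * M - v‖ ≤ δ) :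
    ‖Rs * R - v‖ ≤ δ + (‖v‖ + δ) * η + 2 * ε₁ * B := by
  have e1 : 0 ≤ ε₁ := (norm_nonneg _).trans h1
  have hsplit : Rs * R - v = (m * M - v) + m * (R - M) + (Rs - m) * R := by ring
  have hmM : ‖m * M‖ ≤ ‖v‖ + δ := by
    have h := norm_add_le (m * M - v) v
    rw [sub_add_cancel] at h
    linarith
  have t2 : ‖m * (R - M)‖ ≤ (‖v‖ + δ) * η := by
    rw [norm_mul]
    calc ‖m‖ * ‖R - M‖ ≤ ‖m‖ * (η * ‖M‖) := by gcongr
      _ = η * ‖m * M‖ := by rw [norm_mul]; ring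
      _ ≤ η * (‖v‖ + δ) := by gcongr
      _ = (‖v‖ + δ) * η := by ring
  have hR : ‖R‖ ≤ 2 * B := by
    have h := norm_add_le (R - M) M
    rw [sub_add_cancel] at h
    have hM0 := norm_nonneg M
    nlinarith
  have t3 : ‖(Rs - m) * R‖ ≤ 2 * ε₁ * B := by
    rw [norm_mul]
    calc ‖Rs - m‖ * ‖R‖ ≤ ε₁ * (2 * B) := mul_le_mul h1 hR (norm_nonneg _) e1
      _ = 2 * ε₁ * B := by ring
  rw [hsplit]
  calc ‖m * M - v + m * (R - M) + (Rs - m) * R‖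
      ≤ ‖m * M - v‖ + ‖m * (R - M)‖ + ‖(Rs - m) * R‖ := by
        refine (norm_add_le _ _).trans ?_
        gcongr
        exact norm_add_le _ _
    _ ≤ δ + (‖v‖ + δ) * η + 2 * ε₁ * B := by linarith

/-- `|P/(d₁d₂L′)| ≤ 4/(α²c)` for `|P| = 1`, `|d₁|, |d₂| ≥ α/2`, `|L′| ≥ c`.
[cite: Zhang2022LandauSiegel, §15 p. 88] -/
theorem norm_mainTerm_le {D : ℕ} {P d₁ d₂ L1 : ℂ} {c : ℝ} (hα : 0 < alpha D) (hP : ‖P‖ = 1)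
    (hd₁ : alpha D / 2 ≤ ‖d₁‖) (hd₂ : alpha D / 2 ≤ ‖d₂‖) (hc : 0 < c) (hcL : c ≤ ‖L1‖) :
    ‖P / (d₁ * d₂ * L1)‖ ≤ 4 / (alpha D ^ 2 * c) := by
  rw [norm_div, hP, norm_mul, norm_mul]
  have hden : alpha D / 2 * (alpha D / 2) * c ≤ ‖d₁‖ * ‖d₂‖ * ‖L1‖ := by gcongr
  calc 1 / (‖d₁‖ * ‖d₂‖ * ‖L1‖) ≤ 1 / (alpha D / 2 * (alpha D / 2) * c) :=
        one_div_le_one_div_of_le (by positivity) hden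
    _ = 4 / (alpha D ^ 2 * c) := by field_simp; ring

/-- The common bookkeeping of the three products: with `ε₁ = C₁𝓛⁻²⁴`, `η = C₂𝓛⁻⁶`, `B = 4/(α²c)` and
`δ ≤ K_m/𝓛`, the bound of `product_core_rel` is `≤ (K_m + (|v| + K_m)C₂ + 8C₁/(π²c))/𝓛`.
[cite: Zhang2022LandauSiegel, §15 p. 88] -/
theorem bookkeeping {D : ℕ} (hL : 3 ≤ ell D) {C₁ C₂ c Km δ nv : ℝ} (hC₁ : 0 ≤ C₁) (hC₂ : 0 ≤ C₂)
    (hc : 0 < c) (hKm : 0 ≤ Km) (hnv : 0 ≤ nv) (hδ : δ ≤ Km / ell D) :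
    δ + (nv + δ) * (C₂ / ell D ^ 6) + 2 * (C₁ / ell D ^ 24) * (4 / (alpha D ^ 2 * c)) ≤
      (Km + (nv + Km) * C₂ + 8 * C₁ / (π ^ 2 * c)) / ell D := by
  have hℓ : 0 < ell D := by linarith
  have hℓ1 : 1 ≤ ell D := by linarith
  have hαeq := Section2.alpha_eq_pi_div_ell9 D
  have hα2 : alpha D ^ 2 = π ^ 2 / ell D ^ 18 := by rw [hαeq]; ring
  have t2 : (nv + δ) * (C₂ / ell D ^ 6) ≤ (nv + Km) * C₂ / ell D := by
    have hδ' : δ ≤ Km := hδ.trans (div_le_self hKm hℓ1)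
    have h6 : C₂ / ell D ^ 6 ≤ C₂ / ell D :=
      div_le_div_of_nonneg_left hC₂ hℓ (by
        calc ell D = ell D ^ 1 := (pow_one _).symm
          _ ≤ ell D ^ 6 := pow_le_pow_right₀ hℓ1 (by norm_num))
    calc (nv + δ) * (C₂ / ell D ^ 6) ≤ (nv + Km) * (C₂ / ell D) := by gcongr
      _ = (nv + Km) * C₂ / ell D := by ring
  have t3 : 2 * (C₁ / ell D ^ 24) * (4 / (alpha D ^ 2 * c)) ≤ 8 * C₁ / (π ^ 2 * c) / ell D := by
    rw [hα2]
    rw [show 2 * (C₁ / ell D ^ 24) * (4 / (π ^ 2 / ell D ^ 18 * c)) = 8 * C₁ / (π ^ 2 * c) / ell D ^ 6 by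
      field_simp; ring]
    exact div_le_div_of_nonneg_left (by positivity) hℓ (by
      calc ell D = ell D ^ 1 := (pow_one _).symm
        _ ≤ ell D ^ 6 := pow_le_pow_right₀ hℓ1 (by norm_num))
  rw [add_div, add_div]
  linarith

/-! ## The three products, for the concrete typed objects -/

/-- **`Z22:§15.u060` ⇐ Lemma 5.4 (ii)**: `ℛ₁*ℛ₁₁ = 1 + O(1/𝓛)` for every `X` whose fields `ℛ₁*`, `ℛ₁₁`
are the typed bodies; hypothesis: the CLAIM node `Skeleton.Lemma54` only.
[cite: Zhang2022LandauSiegel, §15 p. 88] -/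
theorem step15_u060_of_lemma54
    (hX58 : ∀ (D : ℕ) [NeZero D] (χ : DirichletCharacter ℂ D),
      X.calR1star c' χ = χ.LFunction (1 + beta1 c' D) * χ.LFunction (1 + beta2 c' D) /
        deriv χ.LFunction 1 * deltaW D 1)
    (hX59 : ∀ (D : ℕ) [NeZero D] (χ : DirichletCharacter ℂ D) (j : ℕ), X.calR1 c' χ j = calR1 c' χ j)
    (h54 : Lemma54) : Step15_u060 c' X := by
  obtain ⟨C₁, h58⟩ := step15_u058_of_lemma54 c' X hX58 h54
  obtain ⟨C₂, hC₂, h59⟩ := calR1_one_rel c'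
  obtain ⟨c, hc, h57⟩ := norm_deriv_LFunction_one_ge
  obtain ⟨D₀, hall⟩ := (h58.and h59).and h57
  set Km : ℝ := 24 * |c'| * π + 2 * 521 * π + 2 * 700 * (|c'| * π) with hKm
  have hKm0 : 0 ≤ Km := by positivity
  refine ⟨Km + (1 + Km) * C₂ + 8 * max C₁ 0 / (π ^ 2 * c),
    max D₀ (max (max ⌈Real.exp 3⌉₊ ⌈Real.exp (14 * |c'| * π)⌉₊) ⌈Real.exp (C₂ + 1)⌉₊),
    fun D _ χ hD hq hp hA => ?_⟩
  have hD₀ : D₀ ≤ D := le_trans (le_max_left _ _) hD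
  obtain ⟨hL, he⟩ := thresholds c' (le_trans (le_trans (le_max_left _ _) (le_max_right _ _)) hD)
  have hℓ : 0 < ell D := by linarith
  have hℓ1 : 1 ≤ ell D := by linarith
  have hα := alpha_pos hL
  have hC₂ℓ : C₂ + 1 ≤ ell D := by
    have h : Real.exp (C₂ + 1) ≤ D :=
      le_trans (Nat.le_ceil _) (by exact_mod_cast le_trans (le_trans (le_max_right _ _) (le_max_right _ _)) hD)
    exact (Real.le_log_iff_exp_le (lt_of_lt_of_le (Real.exp_pos _) h)).mpr h
  have hη1 : C₂ / ell D ^ 6 ≤ 1 := by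
    rw [div_le_one (pow_pos hℓ 6)]
    calc C₂ ≤ ell D := by linarith
      _ = ell D ^ 1 := (pow_one _).symm
      _ ≤ ell D ^ 6 := pow_le_pow_right₀ hℓ1 (by norm_num)
  obtain ⟨⟨g58, g59⟩, g57⟩ := hall D χ hD₀ hq hp
  have hcL := g57 hA
  set L1 : ℂ := deriv χ.LFunction 1 with hL1
  have hL0 : L1 ≠ 0 := by
    intro h; rw [h, norm_zero] at hcL; linarith
  have e58 : ‖X.calR1star c' χ - beta1 c' D * beta2 c' D * L1‖ ≤ max C₁ 0 / ell D ^ 24 :=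
    (g58 hA).trans (by gcongr; exact le_max_left _ _)
  have e59 := g59 hA
  rw [← hX59 D χ 1] at e59
  -- the main term size and the exact cancellation of `L′`
  have he' := abs_le.mp he
  obtain ⟨⟨h21l, -⟩, ⟨h31l, -⟩, -⟩ := norm_beta_sub c' hL he
  have hPn : ‖((P4 D : ℝ) : ℂ) ^ (beta3 c' D - beta1 c' D)‖ = 1 := by
    rw [← betaJ_three c' D, ← betaJ_one c' D]; exact norm_P4_cpow_betaJ_sub c' hL 1 3
  have hB := norm_mainTerm_le hα hPn h21l h31l hc hcL
  have hmM : beta1 c' D * beta2 c' D * L1 * (((P4 D : ℝ) : ℂ) ^ (beta3 c' D - beta1 c' D) /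
      ((beta2 c' D - beta1 c' D) * (beta3 c' D - beta1 c' D) * L1)) =
      beta1 c' D * beta2 c' D * ((P4 D : ℝ) : ℂ) ^ (beta3 c' D - beta1 c' D) /
        ((beta2 c' D - beta1 c' D) * (beta3 c' D - beta1 c' D)) := by
    rw [← mul_div_assoc, show beta1 c' D * beta2 c' D * L1 * ((P4 D : ℝ) : ℂ) ^ (beta3 c' D - beta1 c' D)
      = beta1 c' D * beta2 c' D * ((P4 D : ℝ) : ℂ) ^ (beta3 c' D - beta1 c' D) * L1 by ring,
      mul_div_mul_right _ _ hL0]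
  have hδ := mainTerm_one c' hL he
  rw [← hmM] at hδ
  have hcore := product_core_rel e58 e59 (by positivity) hη1 hB hδ
  have hmain := mainErr_le c' hL 24 2 2 (by norm_num) (by norm_num) (by norm_num)
  refine hcore.trans ?_
  rw [norm_one]
  exact bookkeeping hL (le_max_right C₁ 0) hC₂ hc hKm0 zero_le_one (by rw [hKm]; exact hmain)

/-- **`Z22:§15.u061` ⇐ Lemma 5.4 (ii)**: `ℛ₁*ℛ₁₂ = 2 + O(1/𝓛)`. [cite: Zhang2022LandauSiegel, §15 p. 88] -/
theorem step15_u061_of_lemma54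
    (hX58 : ∀ (D : ℕ) [NeZero D] (χ : DirichletCharacter ℂ D),
      X.calR1star c' χ = χ.LFunction (1 + beta1 c' D) * χ.LFunction (1 + beta2 c' D) /
        deriv χ.LFunction 1 * deltaW D 1)
    (hX59 : ∀ (D : ℕ) [NeZero D] (χ : DirichletCharacter ℂ D) (j : ℕ), X.calR1 c' χ j = calR1 c' χ j)
    (h54 : Lemma54) : Step15_u061 c' X := by
  obtain ⟨C₁, h58⟩ := step15_u058_of_lemma54 c' X hX58 h54
  obtain ⟨C₂, hC₂, h59⟩ := calR1_two_rel c'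
  obtain ⟨c, hc, h57⟩ := norm_deriv_LFunction_one_ge
  obtain ⟨D₀, hall⟩ := (h58.and h59).and h57
  set Km : ℝ := 24 * |c'| * π + 2 * 521 * π + 10 * 700 * (|c'| * π) with hKm
  have hKm0 : 0 ≤ Km := by positivity
  refine ⟨Km + (2 + Km) * C₂ + 8 * max C₁ 0 / (π ^ 2 * c),
    max D₀ (max (max ⌈Real.exp 3⌉₊ ⌈Real.exp (14 * |c'| * π)⌉₊) ⌈Real.exp (C₂ + 1)⌉₊),
    fun D _ χ hD hq hp hA => ?_⟩
  have hD₀ : D₀ ≤ D := le_trans (le_max_left _ _) hD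
  obtain ⟨hL, he⟩ := thresholds c' (le_trans (le_trans (le_max_left _ _) (le_max_right _ _)) hD)
  have hℓ : 0 < ell D := by linarith
  have hℓ1 : 1 ≤ ell D := by linarith
  have hα := alpha_pos hL
  have hC₂ℓ : C₂ + 1 ≤ ell D := by
    have h : Real.exp (C₂ + 1) ≤ D :=
      le_trans (Nat.le_ceil _) (by exact_mod_cast le_trans (le_trans (le_max_right _ _) (le_max_right _ _)) hD)
    exact (Real.le_log_iff_exp_le (lt_of_lt_of_le (Real.exp_pos _) h)).mpr h
  have hη1 : C₂ / ell D ^ 6 ≤ 1 := by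
    rw [div_le_one (pow_pos hℓ 6)]
    calc C₂ ≤ ell D := by linarith
      _ = ell D ^ 1 := (pow_one _).symm
      _ ≤ ell D ^ 6 := pow_le_pow_right₀ hℓ1 (by norm_num)
  obtain ⟨⟨g58, g59⟩, g57⟩ := hall D χ hD₀ hq hp
  have hcL := g57 hA
  set L1 : ℂ := deriv χ.LFunction 1 with hL1
  have hL0 : L1 ≠ 0 := by
    intro h; rw [h, norm_zero] at hcL; linarith
  have e58 : ‖X.calR1star c' χ - beta1 c' D * beta2 c' D * L1‖ ≤ max C₁ 0 / ell D ^ 24 :=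
    (g58 hA).trans (by gcongr; exact le_max_left _ _)
  have e59 := g59 hA
  rw [← hX59 D χ 2] at e59
  have he' := abs_le.mp he
  obtain ⟨⟨h21l, -⟩, -, ⟨h32l, -⟩⟩ := norm_beta_sub c' hL he
  have h12l : alpha D / 2 ≤ ‖beta1 c' D - beta2 c' D‖ := by rw [norm_sub_rev]; exact h21l
  have hPn : ‖((P4 D : ℝ) : ℂ) ^ (beta3 c' D - beta2 c' D)‖ = 1 := by
    rw [← betaJ_three c' D, ← betaJ_two c' D]; exact norm_P4_cpow_betaJ_sub c' hL 2 3
  have hB := norm_mainTerm_le hα hPn h32l h12l hc hcL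
  have hmM : beta1 c' D * beta2 c' D * L1 * (((P4 D : ℝ) : ℂ) ^ (beta3 c' D - beta2 c' D) /
      ((beta3 c' D - beta2 c' D) * (beta1 c' D - beta2 c' D) * L1)) =
      beta1 c' D * beta2 c' D * ((P4 D : ℝ) : ℂ) ^ (beta3 c' D - beta2 c' D) /
        ((beta3 c' D - beta2 c' D) * (beta1 c' D - beta2 c' D)) := by
    rw [← mul_div_assoc, show beta1 c' D * beta2 c' D * L1 * ((P4 D : ℝ) : ℂ) ^ (beta3 c' D - beta2 c' D)
      = beta1 c' D * beta2 c' D * ((P4 D : ℝ) : ℂ) ^ (beta3 c' D - beta2 c' D) * L1 by ring,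
      mul_div_mul_right _ _ hL0]
  have hδ := mainTerm_two c' hL he
  rw [← hmM] at hδ
  have hcore := product_core_rel e58 e59 (by positivity) hη1 hB hδ
  have hmain := mainErr_le c' hL 24 2 10 (by norm_num) (by norm_num) (by norm_num)
  refine hcore.trans ?_
  rw [show ‖(2 : ℂ)‖ = 2 by norm_num]
  exact bookkeeping hL (le_max_right C₁ 0) hC₂ hc hKm0 (by norm_num) (by rw [hKm]; exact hmain)

/-- **`Z22:§15.u062` ⇐ Lemma 5.4 (ii)**: `ℛ₁*ℛ₁₃ = 1 + O(1/𝓛)` (main term exactly `1`).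
[cite: Zhang2022LandauSiegel, §15 p. 88] -/
theorem step15_u062_of_lemma54
    (hX58 : ∀ (D : ℕ) [NeZero D] (χ : DirichletCharacter ℂ D),
      X.calR1star c' χ = χ.LFunction (1 + beta1 c' D) * χ.LFunction (1 + beta2 c' D) /
        deriv χ.LFunction 1 * deltaW D 1)
    (hX59 : ∀ (D : ℕ) [NeZero D] (χ : DirichletCharacter ℂ D) (j : ℕ), X.calR1 c' χ j = calR1 c' χ j)
    (h54 : Lemma54) : Step15_u062 c' X := by
  obtain ⟨C₁, h58⟩ := step15_u058_of_lemma54 c' X hX58 h54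
  obtain ⟨C₂, hC₂, h59⟩ := calR1_three_rel c'
  obtain ⟨c, hc, h57⟩ := norm_deriv_LFunction_one_ge
  obtain ⟨D₀, hall⟩ := (h58.and h59).and h57
  refine ⟨0 + (1 + 0) * C₂ + 8 * max C₁ 0 / (π ^ 2 * c),
    max D₀ (max (max ⌈Real.exp 3⌉₊ ⌈Real.exp (14 * |c'| * π)⌉₊) ⌈Real.exp (C₂ + 1)⌉₊),
    fun D _ χ hD hq hp hA => ?_⟩
  have hD₀ : D₀ ≤ D := le_trans (le_max_left _ _) hD
  obtain ⟨hL, he⟩ := thresholds c' (le_trans (le_trans (le_max_left _ _) (le_max_right _ _)) hD)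
  have hℓ : 0 < ell D := by linarith
  have hℓ1 : 1 ≤ ell D := by linarith
  have hα := alpha_pos hL
  have hC₂ℓ : C₂ + 1 ≤ ell D := by
    have h : Real.exp (C₂ + 1) ≤ D :=
      le_trans (Nat.le_ceil _) (by exact_mod_cast le_trans (le_trans (le_max_right _ _) (le_max_right _ _)) hD)
    exact (Real.le_log_iff_exp_le (lt_of_lt_of_le (Real.exp_pos _) h)).mpr h
  have hη1 : C₂ / ell D ^ 6 ≤ 1 := by
    rw [div_le_one (pow_pos hℓ 6)]
    calc C₂ ≤ ell D := by linarith
      _ = ell D ^ 1 := (pow_one _).symm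
      _ ≤ ell D ^ 6 := pow_le_pow_right₀ hℓ1 (by norm_num)
  obtain ⟨⟨g58, g59⟩, g57⟩ := hall D χ hD₀ hq hp
  have hcL := g57 hA
  set L1 : ℂ := deriv χ.LFunction 1 with hL1
  have hL0 : L1 ≠ 0 := by
    intro h; rw [h, norm_zero] at hcL; linarith
  have e58 : ‖X.calR1star c' χ - beta1 c' D * beta2 c' D * L1‖ ≤ max C₁ 0 / ell D ^ 24 :=
    (g58 hA).trans (by gcongr; exact le_max_left _ _)
  have e59 := g59 hA
  rw [← hX59 D χ 3] at e59
  have he' := abs_le.mp he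
  obtain ⟨-, ⟨h31l, -⟩, ⟨h32l, -⟩⟩ := norm_beta_sub c' hL he
  have h13l : alpha D / 2 ≤ ‖beta1 c' D - beta3 c' D‖ := by rw [norm_sub_rev]; exact h31l
  have h23l : alpha D / 2 ≤ ‖beta2 c' D - beta3 c' D‖ := by rw [norm_sub_rev]; exact h32l
  have hPn : ‖((P4 D : ℝ) : ℂ) ^ (beta3 c' D - beta3 c' D)‖ = 1 := by
    rw [← betaJ_three c' D]; exact norm_P4_cpow_betaJ_sub c' hL 3 3
  have hB := norm_mainTerm_le hα hPn h13l h23l hc hcL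
  have hmM : beta1 c' D * beta2 c' D * L1 * (((P4 D : ℝ) : ℂ) ^ (beta3 c' D - beta3 c' D) /
      ((beta1 c' D - beta3 c' D) * (beta2 c' D - beta3 c' D) * L1)) =
      beta1 c' D * beta2 c' D * ((P4 D : ℝ) : ℂ) ^ (beta3 c' D - beta3 c' D) /
        ((beta1 c' D - beta3 c' D) * (beta2 c' D - beta3 c' D)) := by
    rw [← mul_div_assoc, show beta1 c' D * beta2 c' D * L1 * ((P4 D : ℝ) : ℂ) ^ (beta3 c' D - beta3 c' D)
      = beta1 c' D * beta2 c' D * ((P4 D : ℝ) : ℂ) ^ (beta3 c' D - beta3 c' D) * L1 by ring,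
      mul_div_mul_right _ _ hL0]
  have hδ : ‖beta1 c' D * beta2 c' D * L1 * (((P4 D : ℝ) : ℂ) ^ (beta3 c' D - beta3 c' D) /
      ((beta1 c' D - beta3 c' D) * (beta2 c' D - beta3 c' D) * L1)) - 1‖ ≤ 0 := by
    rw [hmM, mainTerm_three c' hα he, sub_self, norm_zero]
  have hcore := product_core_rel e58 e59 (by positivity) hη1 hB hδ
  refine hcore.trans ?_
  rw [norm_one]
  exact bookkeeping hL (le_max_right C₁ 0) hC₂ hc le_rfl zero_le_one (by rw [zero_div])

/-! ## Unconditional forms (Lemma 5.4 is the tree's `Skeleton.lemma54_holds`) -/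

/-- **`Z22:§15.u058` HOLDS** for every `X` whose field `ℛ₁*` is the typed body (§15 p. 88: "By Lemma 5.8,
`ℛ₁* = β₁β₂L′(1,χ) + O(1/𝓛²⁴)`"). [cite: Zhang2022LandauSiegel, §15 p. 88] -/
theorem step15_u058_holds
    (hX58 : ∀ (D : ℕ) [NeZero D] (χ : DirichletCharacter ℂ D),
      X.calR1star c' χ = χ.LFunction (1 + beta1 c' D) * χ.LFunction (1 + beta2 c' D) /
        deriv χ.LFunction 1 * deltaW D 1) :
    Step15_u058 c' X :=
  step15_u058_of_lemma54 c' X hX58 lemma54_holds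

/-- **`Z22:§15.u060` HOLDS** for every instantiation `X` whose fields `ℛ₁*`, `ℛ₁ⱼ` are the typed bodies
(§15 p. 88: `ℛ₁*ℛ₁₁ = 1 + O(1/𝓛)`). [cite: Zhang2022LandauSiegel, §15 p. 88] -/
theorem step15_u060_holds
    (hX58 : ∀ (D : ℕ) [NeZero D] (χ : DirichletCharacter ℂ D),
      X.calR1star c' χ = χ.LFunction (1 + beta1 c' D) * χ.LFunction (1 + beta2 c' D) /
        deriv χ.LFunction 1 * deltaW D 1)
    (hX59 : ∀ (D : ℕ) [NeZero D] (χ : DirichletCharacter ℂ D) (j : ℕ), X.calR1 c' χ j = calR1 c' χ j) :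
    Step15_u060 c' X :=
  step15_u060_of_lemma54 c' X hX58 hX59 lemma54_holds

/-- **`Z22:§15.u061` HOLDS** (`ℛ₁*ℛ₁₂ = 2 + O(1/𝓛)`) for such `X`. [cite: Zhang2022LandauSiegel, §15 p. 88] -/
theorem step15_u061_holds
    (hX58 : ∀ (D : ℕ) [NeZero D] (χ : DirichletCharacter ℂ D),
      X.calR1star c' χ = χ.LFunction (1 + beta1 c' D) * χ.LFunction (1 + beta2 c' D) /
        deriv χ.LFunction 1 * deltaW D 1)
    (hX59 : ∀ (D : ℕ) [NeZero D] (χ : DirichletCharacter ℂ D) (j : ℕ), X.calR1 c' χ j = calR1 c' χ j) :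
    Step15_u061 c' X :=
  step15_u061_of_lemma54 c' X hX58 hX59 lemma54_holds

/-- **`Z22:§15.u062` HOLDS** (`ℛ₁*ℛ₁₃ = 1 + O(1/𝓛)`) for such `X`. [cite: Zhang2022LandauSiegel, §15 p. 88] -/
theorem step15_u062_holds
    (hX58 : ∀ (D : ℕ) [NeZero D] (χ : DirichletCharacter ℂ D),
      X.calR1star c' χ = χ.LFunction (1 + beta1 c' D) * χ.LFunction (1 + beta2 c' D) /
        deriv χ.LFunction 1 * deltaW D 1)
    (hX59 : ∀ (D : ℕ) [NeZero D] (χ : DirichletCharacter ℂ D) (j : ℕ), X.calR1 c' χ j = calR1 c' χ j) :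
    Step15_u062 c' X :=
  step15_u062_of_lemma54 c' X hX58 hX59 lemma54_holds

end Literature.NumberTheory.LFunctions.Zhang2022.ResidueValues
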